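import Summits.CriticalPhenomena.PercolationContinuityZ3.Theorems.PercNearOneGluingNoHeavyQuantIndepBlobThinning
import HarnessLib

/-!
# QUANT lane R8, FAR for independent blobs (V): HALF-ROW — block-star FAR half a level up,
# `EW > 2y − 3 ⟹ P(W ≥ y) ≥ (min gate)/2` for integer blob sizes

builds on p205010 (kernel theorem, internal audit signed; external expert review pending)

Support file (`--supports stmt-CriticalPhenomena-4575`), QUANT lane census-2 (gen 46); memo
`run/shared/lean/prim/quant/prim-quant-census-2-g46/HALF-ROW-PROOF.md`; answers residual lemma 1 (HALF-ROW, §6) of census-1 gen 10's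
`run/shared/lean/prim/quant/prim-quant-census-1/PROFILE-PROOF-G10.md` (proof of the profile conjecture `Quant.HubBlocksProfileIneq` modulo
two blob-sum lemmas).

**Setting** (vocabulary of `…QuantIndepBlobMoments/…FarMin`).  A finite type `κ` of blobs, gates `p : κ → ℝ` (`0 ≤ p k ≤ 1`), INTEGER sizes
`a : κ → ℕ` with `1 ≤ a k`; a configuration is the set `s : Finset κ` of open gates, with product-Bernoulli weight
`∏ k, (if k ∈ s then p k else 1 − p k)`, and `W(s) = ∑_{k ∈ s} a k` is the blob sum.  Block-star FAR (`far_indepBlob_min`) says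
`2j < EW ⟹ P(W ≤ j) ≤ 1 − min gate`, i.e. for an integer level `y`: `EW > 2y − 2 ⟹ P(W ≥ y) ≥ min gate`.

**Theorem (HALF-ROW, `halfRow`).**  For an integer level `y` and a least reliable gate `y₀` (`p y₀ ≤ p k` for all `k`):
`2y − 3 < EW = ∑ a k · p k ⟹ P(W ≥ y) ≥ p y₀ / 2`.  Layer form (`halfRow_lowerTail`): `2j − 1 < EW ⟹ P(W ≤ j) ≤ 1 − p y₀/2` for real `j`.
The constant `1/2` is sharp (`W = ζ(q) + ζ(q)`, `y = 2`, `q ↓ 1/2`), and integrality of the sizes is needed (one blob of size `3/2`, gate 1, `y = 2`).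

**Proof.**  `y ≤ 1`: `P(W ≥ 1) ≥ P(y₀ open) = p y₀`.  Let `y ≥ 2`.
CASE I (some gate `p x₀ ≥ 1/2`, `halfRow_of_half_le_gate`): keep only the configurations containing `x₀` and apply block-star FAR to the
other blobs (on the subtype `{k // k ≠ x₀}`) at `j = y − a x₀ − 1`: `2j < EW − a x₀ · p x₀` because `a x₀ (2 − p x₀) ≥ 1`; so
`P(W ≥ y) ≥ p x₀ · (min gate) ≥ p y₀/2`.
CASE II (all gates `≤ 1/2`, `halfRow_of_gate_le_half`): DOUBLING COUPLING.  The product weight with gates `p = (2p)·(1/2)` is the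
`2p`-product weight of a random set `S` followed by independent fair coins on `S` (`sum_weight_thin`).  For a fixed `S` with
`∑_{k∈S} a k ≥ 2y − 2` at least a quarter of the subsets `t ⊆ S` have `∑_{k∈t} a k ≥ y` (`quarter_le_sum_powerset_heavy`, the REFLECTION
argument).  Hence `P(W ≥ y) ≥ ¼ · P_{2p}(∑_S a ≥ 2y − 2) ≥ ¼ · 2 p y₀` by block-star FAR for the doubled gates at `j = 2y − 3`.
No sorries; standard axioms; no new definitions.  Exact second-engine check of the statement and of every step of this chain:
424 227 rational instances, 0 failures (memo above).
-/

namespace Summit.CriticalPhenomena.PercolationContinuityZ3.Theorems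

namespace Quant

namespace IndepBlob

open Finset

variable {κ : Type*} [Fintype κ] [DecidableEq κ]

/-! ### 3. HALF-ROW -/

/-- **HALF-ROW, Case I** (some gate `p x₀ ≥ 1/2`).  Keep the configurations containing `x₀` and apply block-star FAR
(`far_indepBlob_min`) to the other blobs at `j = y − a x₀ − 1` (`2j < EW − a x₀ p x₀` since `a x₀ (2 − p x₀) ≥ 1`):
`P(W ≥ y) ≥ p x₀ · P(W' ≥ y − a x₀) ≥ p x₀ · min gate ≥ p y₀ / 2`. [this work] -/
theorem halfRow_of_half_le_gate (p : κ → ℝ) (a : κ → ℕ) (hp0 : ∀ k, 0 ≤ p k) (hp1 : ∀ k, p k ≤ 1)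
    (ha : ∀ k, 1 ≤ a k) (y₀ : κ) (hy₀ : ∀ k, p y₀ ≤ p k) (y : ℕ)
    (h : 2 * (y : ℝ) - 3 < ∑ k, (a k : ℝ) * p k) (x₀ : κ) (hx₀ : 1 / 2 ≤ p x₀) :
    p y₀ / 2 ≤ ∑ s ∈ (Finset.univ : Finset (Finset κ)).filter (fun s => y ≤ ∑ k ∈ s, a k),
      (∏ k, if k ∈ s then p k else 1 - p k) := by
  set ι := {k : κ // k ≠ x₀} with hι
  set emb : ι ↪ κ := Function.Embedding.subtype _ with hemb
  have hw0 : ∀ s : Finset κ, 0 ≤ (∏ k, if k ∈ s then p k else 1 - p k) := bernoulliWeight_nonneg hp0 hp1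
  have hw0' : ∀ W : Finset ι, 0 ≤ (∏ i : ι, if i ∈ W then p i else 1 - p i) :=
    bernoulliWeight_nonneg (fun i => hp0 i) (fun i => hp1 i)
  set G : Finset κ → ℝ := fun s =>
    if y ≤ ∑ k ∈ s, a k then (∏ k, if k ∈ s then p k else 1 - p k) else 0 with hG
  have hG0 : ∀ s, 0 ≤ G s := fun s => by
    simp only [hG]
    split_ifs
    · exact hw0 s
    · exact le_rfl
  have hLHS : ∑ s ∈ (Finset.univ : Finset (Finset κ)).filter (fun s => y ≤ ∑ k ∈ s, a k),
      (∏ k, if k ∈ s then p k else 1 - p k) = ∑ s : Finset κ, G s := by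
    rw [hG, Finset.sum_filter]
  have hsplit : ∑ s : Finset κ, G s =
      ∑ W : Finset ι, G (W.map emb) + ∑ W : Finset ι, G (insert x₀ (W.map emb)) := by
    rw [← Finset.powerset_univ, ← Finset.insert_erase (Finset.mem_univ x₀),
      Finset.sum_powerset_insert (Finset.notMem_erase x₀ _), sum_powerset_erase_eq_sum_subtype,
      sum_powerset_erase_eq_sum_subtype]
  have hnot : ∀ W : Finset ι, x₀ ∉ W.map emb := by
    intro W hW
    rw [Finset.mem_map] at hW
    obtain ⟨i, -, hi⟩ := hW
    exact i.2 hi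
  -- the part of the event through `x₀`
  set T : ℝ := ∑ W ∈ (Finset.univ : Finset (Finset ι)).filter (fun W : Finset ι => y ≤ a x₀ + ∑ i ∈ W, a (i : κ)),
      (∏ i : ι, if i ∈ W then p i else 1 - p i) with hT
  have h1 : ∑ W : Finset ι, G (insert x₀ (W.map emb)) = p x₀ * T := by
    rw [hT, Finset.sum_filter, Finset.mul_sum]
    refine Finset.sum_congr rfl fun W _ => ?_
    have hX : ∑ k ∈ insert x₀ (W.map emb), a k = a x₀ + ∑ i ∈ W, a (i : κ) := by
      rw [Finset.sum_insert (hnot W), Finset.sum_map]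
      rfl
    simp only [hG, hX]
    split_ifs
    · rw [hemb, prod_ite_mem_insert_map_subtype]
    · rw [mul_zero]
  have h0 : 0 ≤ ∑ W : Finset ι, G (W.map emb) := Finset.sum_nonneg fun W _ => hG0 _
  have ha1 : (1 : ℝ) ≤ a x₀ := by exact_mod_cast ha x₀
  -- `T ≥ p y₀`
  have hTge : p y₀ ≤ T := by
    rcases isEmpty_or_nonempty ι with hιe | hιn
    · -- `κ = {x₀}`: the hypothesis forces `y ≤ a x₀`, and the empty configuration of `ι` has weight one
      have hsum : ∑ k, (a k : ℝ) * p k = (a x₀ : ℝ) * p x₀ :=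
        Finset.sum_eq_single x₀ (fun k _ hk => (hιe.false ⟨k, hk⟩).elim) fun hx => absurd (Finset.mem_univ x₀) hx
      rw [hsum] at h
      have hax : (a x₀ : ℝ) * p x₀ ≤ a x₀ := by nlinarith [hp1 x₀]
      have h' : (2 * y : ℝ) < (a x₀ : ℝ) + 3 := by linarith
      have h'' : 2 * y < a x₀ + 3 := by exact_mod_cast h'
      have hyA : y ≤ a x₀ + ∑ i ∈ (∅ : Finset ι), a (i : κ) := by
        rw [Finset.sum_empty, add_zero]
        have := ha x₀
        omega
      have hmem : (∅ : Finset ι) ∈ (Finset.univ : Finset (Finset ι)).filter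
          (fun W : Finset ι => y ≤ a x₀ + ∑ i ∈ W, a (i : κ)) :=
        Finset.mem_filter.2 ⟨Finset.mem_univ _, hyA⟩
      have hle := Finset.single_le_sum (f := fun W : Finset ι => (∏ i : ι, if i ∈ W then p i else 1 - p i))
        (fun W _ => hw0' W) hmem
      have hempty : (∏ i : ι, if i ∈ (∅ : Finset ι) then p i else 1 - p i) = 1 := by
        rw [Finset.univ_eq_empty, Finset.prod_empty]
      rw [hempty] at hle
      exact (hp1 y₀).trans hle
    · -- apply block-star FAR to the blobs `≠ x₀`
      obtain ⟨y', -, hy'⟩ := Finset.exists_min_image Finset.univ (fun i : ι => p i) Finset.univ_nonempty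
      have hm' : ∑ k, (a k : ℝ) * p k = (a x₀ : ℝ) * p x₀ + ∑ i : ι, (a i : ℝ) * p i := by
        rw [← Finset.add_sum_erase Finset.univ _ (Finset.mem_univ x₀),
          Finset.sum_subtype (Finset.univ.erase x₀) (p := fun k => k ≠ x₀) (fun k => by simp)]
      set j : ℝ := (y : ℝ) - a x₀ - 1 with hj
      have hjm : 2 * j < ∑ i : ι, (a i : ℝ) * p i := by
        have : (1 : ℝ) ≤ (a x₀ : ℝ) * (2 - p x₀) := by nlinarith [hp1 x₀, hp0 x₀]
        rw [hm'] at h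
        rw [hj]
        nlinarith
      have hfar := far_indepBlob_min (fun i : ι => p i) (fun i : ι => (a i : ℝ)) (fun i => hp0 i) (fun i => hp1 i)
        (fun i => by positivity) y' (fun i => hy' i (Finset.mem_univ i)) j hjm
      -- complement of the event inside `ι`
      have hcompl := Finset.sum_filter_add_sum_filter_not (Finset.univ : Finset (Finset ι))
        (fun W : Finset ι => y ≤ a x₀ + ∑ i ∈ W, a (i : κ)) (fun W : Finset ι => (∏ i : ι, if i ∈ W then p i else 1 - p i))
      rw [sum_bernoulliWeight (fun i : ι => p i)] at hcompl
      have hsub : ∑ W ∈ (Finset.univ : Finset (Finset ι)).filter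
          (fun W : Finset ι => ¬ (y ≤ a x₀ + ∑ i ∈ W, a (i : κ))),
          (∏ i : ι, if i ∈ W then p i else 1 - p i) ≤
          ∑ W ∈ (Finset.univ : Finset (Finset ι)).filter (fun W : Finset ι => ∑ i ∈ W, (a (i : κ) : ℝ) ≤ j),
          (∏ i : ι, if i ∈ W then p i else 1 - p i) := by
        refine Finset.sum_le_sum_of_subset_of_nonneg (fun W hW => ?_) fun W _ _ => hw0' W
        rw [Finset.mem_filter] at hW ⊢
        refine ⟨hW.1, ?_⟩
        have hlt : a x₀ + ∑ i ∈ W, a (i : κ) + 1 ≤ y := by have := hW.2; omega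
        have hcast : ((a x₀ + ∑ i ∈ W, a (i : κ) + 1 : ℕ) : ℝ) ≤ y := by exact_mod_cast hlt
        push_cast at hcast
        rw [hj]
        linarith
      have hyy : p y₀ ≤ p y' := hy₀ y'
      linarith
  -- assemble
  rw [hLHS, hsplit, h1]
  have : p y₀ / 2 ≤ p x₀ * T := by
    have h2 : p x₀ * p y₀ ≤ p x₀ * T := mul_le_mul_of_nonneg_left hTge (hp0 x₀)
    nlinarith [hp0 y₀]
  linarith

/-- **HALF-ROW, Case II** (all gates `≤ 1/2`, level `y ≥ 2`).  Doubling coupling (`sum_weight_thin` with gates `2p · ½`), the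
reflection count on each doubled configuration `S` with `∑_{k∈S} a k ≥ 2y − 2` (`quarter_le_sum_powerset_heavy`), and block-star FAR
for the doubled gates at `j = 2y − 3`: `P(W ≥ y) ≥ ¼ · P_{2p}(∑_S a ≥ 2y − 2) ≥ ¼ · 2 p y₀`. [this work] -/
theorem halfRow_of_gate_le_half (p : κ → ℝ) (a : κ → ℕ) (hp0 : ∀ k, 0 ≤ p k) (hhalf : ∀ k, p k ≤ 1 / 2)
    (ha : ∀ k, 1 ≤ a k) (y₀ : κ) (hy₀ : ∀ k, p y₀ ≤ p k) (y : ℕ) (hy : 2 ≤ y)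
    (h : 2 * (y : ℝ) - 3 < ∑ k, (a k : ℝ) * p k) :
    p y₀ / 2 ≤ ∑ s ∈ (Finset.univ : Finset (Finset κ)).filter (fun s => y ≤ ∑ k ∈ s, a k),
      (∏ k, if k ∈ s then p k else 1 - p k) := by
  set q : κ → ℝ := fun k => 2 * p k with hq
  have hq0 : ∀ k, 0 ≤ q k := fun k => by simp only [hq]; linarith [hp0 k]
  have hq1 : ∀ k, q k ≤ 1 := fun k => by simp only [hq]; linarith [hhalf k]
  have hwq0 : ∀ S : Finset κ, 0 ≤ (∏ k, if k ∈ S then q k else 1 - q k) := bernoulliWeight_nonneg hq0 hq1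
  set F : Finset κ → ℝ := fun s => if y ≤ ∑ k ∈ s, a k then (1 : ℝ) else 0 with hF
  have hF0 : ∀ s, 0 ≤ F s := fun s => by simp only [hF]; split_ifs <;> norm_num
  -- the event probability as `∑_s w_{q·½}(s) F(s)`
  have hLHS : ∑ s ∈ (Finset.univ : Finset (Finset κ)).filter (fun s => y ≤ ∑ k ∈ s, a k),
      (∏ k, if k ∈ s then p k else 1 - p k) =
      ∑ s : Finset κ, (∏ k, if k ∈ s then q k * (1 / 2) else 1 - q k * (1 / 2)) * F s := by
    rw [Finset.sum_filter]
    refine Finset.sum_congr rfl fun s _ => ?_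
    have hw : (∏ k, if k ∈ s then p k else 1 - p k) = ∏ k, (if k ∈ s then q k * (1 / 2) else 1 - q k * (1 / 2)) := by
      refine Finset.prod_congr rfl fun k _ => ?_
      have : q k * (1 / 2) = p k := by simp only [hq]; ring
      rw [this]
    simp only [hF, hw]
    split_ifs <;> simp
  rw [hLHS, sum_weight_thin q (fun _ => (1 / 2 : ℝ)) F]
  -- inner sums are nonnegative, and at least `1/4` on the doubled configurations of size `≥ 2y − 2`
  have hinner0 : ∀ S : Finset κ, 0 ≤ ∑ t ∈ S.powerset,
      (∏ k ∈ S, if k ∈ t then (1 / 2 : ℝ) else 1 - 1 / 2) * F t := by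
    intro S
    refine Finset.sum_nonneg fun t _ => mul_nonneg (Finset.prod_nonneg fun k _ => ?_) (hF0 t)
    split_ifs <;> norm_num
  set P2 := (Finset.univ : Finset (Finset κ)).filter (fun S => 2 * y ≤ ∑ k ∈ S, a k + 2) with hP2
  have hstep1 : ∑ S ∈ P2, (∏ k, if k ∈ S then q k else 1 - q k) * (1 / 4) ≤
      ∑ S : Finset κ, (∏ k, if k ∈ S then q k else 1 - q k) *
        ∑ t ∈ S.powerset, (∏ k ∈ S, if k ∈ t then (1 / 2 : ℝ) else 1 - 1 / 2) * F t := by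
    calc ∑ S ∈ P2, (∏ k, if k ∈ S then q k else 1 - q k) * (1 / 4)
        ≤ ∑ S ∈ P2, (∏ k, if k ∈ S then q k else 1 - q k) *
            ∑ t ∈ S.powerset, (∏ k ∈ S, if k ∈ t then (1 / 2 : ℝ) else 1 - 1 / 2) * F t := by
          refine Finset.sum_le_sum fun S hS => mul_le_mul_of_nonneg_left ?_ (hwq0 S)
          rw [hP2, Finset.mem_filter] at hS
          exact quarter_le_sum_powerset_heavy S a ha y hS.2 hy
      _ ≤ _ := Finset.sum_le_sum_of_subset_of_nonneg (Finset.filter_subset _ _)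
            fun S _ _ => mul_nonneg (hwq0 S) (hinner0 S)
  -- block-star FAR for the doubled gates
  have hjm : 2 * (2 * (y : ℝ) - 3) < ∑ k, (a k : ℝ) * q k := by
    have : ∑ k, (a k : ℝ) * q k = 2 * ∑ k, (a k : ℝ) * p k := by
      rw [Finset.mul_sum]
      refine Finset.sum_congr rfl fun k _ => ?_
      simp only [hq]
      ring
    rw [this]
    linarith
  have hfar := far_indepBlob_min q (fun k => (a k : ℝ)) hq0 hq1 (fun k => by positivity) y₀
    (fun k => by simp only [hq]; linarith [hy₀ k]) (2 * (y : ℝ) - 3) hjm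
  have hcompl := Finset.sum_filter_add_sum_filter_not (Finset.univ : Finset (Finset κ))
    (fun S => 2 * y ≤ ∑ k ∈ S, a k + 2) (fun S => (∏ k, if k ∈ S then q k else 1 - q k))
  rw [sum_bernoulliWeight q] at hcompl
  have hsub : ∑ S ∈ (Finset.univ : Finset (Finset κ)).filter (fun S => ¬ (2 * y ≤ ∑ k ∈ S, a k + 2)),
      (∏ k, if k ∈ S then q k else 1 - q k) ≤
      ∑ S ∈ (Finset.univ : Finset (Finset κ)).filter (fun S => ∑ k ∈ S, (a k : ℝ) ≤ 2 * (y : ℝ) - 3),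
      (∏ k, if k ∈ S then q k else 1 - q k) := by
    refine Finset.sum_le_sum_of_subset_of_nonneg (fun S hS => ?_) fun S _ _ => hwq0 S
    rw [Finset.mem_filter] at hS ⊢
    refine ⟨hS.1, ?_⟩
    have hlt : ∑ k ∈ S, a k + 3 ≤ 2 * y := by have := hS.2; omega
    have hcast : ((∑ k ∈ S, a k + 3 : ℕ) : ℝ) ≤ ((2 * y : ℕ) : ℝ) := by exact_mod_cast hlt
    push_cast at hcast
    linarith
  have hP2ge : 2 * p y₀ ≤ ∑ S ∈ P2, (∏ k, if k ∈ S then q k else 1 - q k) := by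
    have hqy : q y₀ = 2 * p y₀ := by simp only [hq]
    rw [hP2]
    linarith
  rw [← Finset.sum_mul] at hstep1
  linarith

/-- **HALF-ROW (block-star FAR half a level up).**  Gates `0 ≤ p k ≤ 1`, integer sizes `a k ≥ 1`, a least reliable gate `y₀`
(`p y₀ ≤ p k` for all `k`), an integer level `y`.  If `EW = ∑ a k · p k > 2y − 3` then
`P(W ≥ y) = ∑_{s : y ≤ ∑_{k∈s} a k} ∏_k (p k if k ∈ s else 1 − p k) ≥ p y₀ / 2`.
(Block-star FAR `far_indepBlob_min` is `EW > 2y − 2 ⟹ P(W ≥ y) ≥ p y₀`; the constant `1/2` here is sharp.)  Residual lemma 1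
of census-1 gen 10's proof of `Quant.HubBlocksProfileIneq` (PROFILE-PROOF-G10 §6). [this work] -/
theorem halfRow (p : κ → ℝ) (a : κ → ℕ) (hp0 : ∀ k, 0 ≤ p k) (hp1 : ∀ k, p k ≤ 1) (ha : ∀ k, 1 ≤ a k)
    (y₀ : κ) (hy₀ : ∀ k, p y₀ ≤ p k) (y : ℕ) (h : 2 * (y : ℝ) - 3 < ∑ k, (a k : ℝ) * p k) :
    p y₀ / 2 ≤ ∑ s ∈ (Finset.univ : Finset (Finset κ)).filter (fun s => y ≤ ∑ k ∈ s, a k),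
      (∏ k, if k ∈ s then p k else 1 - p k) := by
  have hw0 : ∀ s : Finset κ, 0 ≤ (∏ k, if k ∈ s then p k else 1 - p k) := bernoulliWeight_nonneg hp0 hp1
  rcases Nat.lt_or_ge y 2 with hy | hy
  · -- `y ≤ 1`: the configurations containing `y₀` are in the event
    calc p y₀ / 2 ≤ p y₀ := by linarith [hp0 y₀]
      _ = ∑ W : Finset κ, (∏ k, if k ∈ W then p k else 1 - p k) * (if y₀ ∈ W then (1 : ℝ) else 0) :=
          (sum_bernoulliWeight_mul_indicator p y₀).symm
      _ ≤ _ := by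
          rw [Finset.sum_filter]
          refine Finset.sum_le_sum fun s _ => ?_
          by_cases hs : y₀ ∈ s
          · have hys : y ≤ ∑ k ∈ s, a k := by
              have h1 : a y₀ ≤ ∑ k ∈ s, a k := Finset.single_le_sum (fun k _ => Nat.zero_le (a k)) hs
              have h2 := ha y₀
              omega
            rw [if_pos hs, if_pos hys, mul_one]
          · rw [if_neg hs, mul_zero]
            split_ifs
            · exact hw0 s
            · exact le_rfl
  · by_cases hx : ∃ x₀, 1 / 2 ≤ p x₀
    · obtain ⟨x₀, hx₀⟩ := hx
      exact halfRow_of_half_le_gate p a hp0 hp1 ha y₀ hy₀ y h x₀ hx₀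
    · push Not at hx
      exact halfRow_of_gate_le_half p a hp0 (fun k => (hx k).le) ha y₀ hy₀ y hy h

/-- **HALF-ROW, layer form.**  With the data of `halfRow` and a real `j` with `2j − 1 < EW`:
`P(W ≤ j) = ∑_{s : ∑_{k∈s} a k ≤ j} ∏_k (p k if k ∈ s else 1 − p k) ≤ 1 − p y₀ / 2` — compare `far_indepBlob_min`
(`2j < EW ⟹ P(W ≤ j) ≤ 1 − p y₀`): half a level higher at the price of half the gate. [this work] -/
theorem halfRow_lowerTail (p : κ → ℝ) (a : κ → ℕ) (hp0 : ∀ k, 0 ≤ p k) (hp1 : ∀ k, p k ≤ 1) (ha : ∀ k, 1 ≤ a k)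
    (y₀ : κ) (hy₀ : ∀ k, p y₀ ≤ p k) (j : ℝ) (hj : 2 * j - 1 < ∑ k, (a k : ℝ) * p k) :
    ∑ s ∈ (Finset.univ : Finset (Finset κ)).filter (fun s => ∑ k ∈ s, (a k : ℝ) ≤ j),
      (∏ k, if k ∈ s then p k else 1 - p k) ≤ 1 - p y₀ / 2 := by
  rcases lt_or_ge j 0 with hj0 | hj0
  · -- empty event
    have hempty : (Finset.univ : Finset (Finset κ)).filter (fun s => ∑ k ∈ s, (a k : ℝ) ≤ j) = ∅ := by
      rw [Finset.filter_eq_empty_iff]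
      intro s _ hs
      have : 0 ≤ ∑ k ∈ s, (a k : ℝ) := Finset.sum_nonneg fun k _ => by positivity
      linarith
    rw [hempty, Finset.sum_empty]
    linarith [hp1 y₀]
  · set y : ℕ := ⌊j⌋₊ + 1 with hy
    have hfl := Nat.floor_le hj0
    have hyj : 2 * (y : ℝ) - 3 < ∑ k, (a k : ℝ) * p k := by
      have : (y : ℝ) = (⌊j⌋₊ : ℝ) + 1 := by rw [hy]; push_cast; ring
      rw [this]
      linarith
    have key := halfRow p a hp0 hp1 ha y₀ hy₀ y hyj
    have hiff : ∀ s ∈ (Finset.univ : Finset (Finset κ)), (∑ k ∈ s, (a k : ℝ) ≤ j) ↔ ¬ (y ≤ ∑ k ∈ s, a k) := by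
      intro s _
      rw [not_le, hy]
      constructor
      · intro hs
        have h1 : ((∑ k ∈ s, a k : ℕ) : ℝ) ≤ j := by push_cast; exact hs
        have h2 := Nat.le_floor h1
        omega
      · intro hs
        have hs' : ∑ k ∈ s, a k ≤ ⌊j⌋₊ := by omega
        have h1 : ((∑ k ∈ s, a k : ℕ) : ℝ) ≤ (⌊j⌋₊ : ℝ) := by exact_mod_cast hs'
        push_cast at h1
        linarith
    rw [Finset.filter_congr hiff]
    have hcompl := Finset.sum_filter_add_sum_filter_not (Finset.univ : Finset (Finset κ))
      (fun s => y ≤ ∑ k ∈ s, a k) (fun s => (∏ k, if k ∈ s then p k else 1 - p k))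
    rw [sum_bernoulliWeight p] at hcompl
    linarith

end IndepBlob

end Quant

end Summit.CriticalPhenomena.PercolationContinuityZ3.Theorems
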